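import Literature.AnabelianGeometry.EtaleTheta.GalSectDotCCuspDecompCriterion
import Literature.AnabelianGeometry.EtaleTheta.SettingModelTateMuTwoCusp
import HarnessLib

/-!
# The `DotCCusp` splitting criterion FAILS at the STAGE-2 `b`-axis cusp model `MuTwoSetting.modelχq′` as well

S. Mochizuki, *The étale theta function …* [EtTh], Publ. RIMS **45** (2009), Def. 1.7 p. 27, Thm. 1.10 (iii) p. 30
[cite: MochizukiEtTh2009, Def 1.7 p.27].  abc-iut cell, layer L2, seat abc-iut-w5-d029 (gen 5); PROOF-ONLY stage-2 model companion of this seat's `GalSectDotCCuspDecompCriterion` (p443221; the stage-1 twin at `MuTwoSetting.modelχ′` follows once that record's olean is on the hub): over abc-iut-w5-d249's genuine-inversion record transcribed to the cusp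
(`MuTwoSetting.modelχq′ p i j hj`, F8qc `SettingModelTateMuTwoCusp`; `Π^tp_Ẍ = Ker parityχq`, `ε_μ = b`), the element
`b ∈ D_x = b^Ẑ ⋊ G_{ℚ_p}` has parity `(0,1) = parity(ε_μ)` (abc-iut-w5-d249's `inl_b_not_mem_Xddχq`) while an admissible `ε_Z` has
parity `∉ {0, parity(ε_μ)}`, so the cusp does not split in `Ẋ → X` and **`DotCCusp` / `DotCCuspTorsor` are EMPTY for every
admissible `ε_Z`, every `i` and every even `j`** — `isEmpty_dotCCusp_modelχq'`, `isEmpty_dotCCuspTorsor_modelχq'`, and the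
census form `MuTwoSetting.exists_tate_isCusp_and_forall_isEmpty_dotCCusp`.  The inversion being genuine at stage 2 does not help:
the obstruction is the cusp AXIS.  «Empty at this model» ≠ «unsatisfiable»; semi-synthetic model; nothing of [EtTh] asserted;
no side taken on [IUTchIII] Cor. 3.12; typed ≠ proved.
-/

noncomputable section

namespace Literature.AnabelianGeometry.EtaleTheta.SettingModel

open Literature.AnabelianGeometry.SemiGraphs

variable (p : ℕ) [Fact p.Prime] (i j : ℤ) (hj : Even j)

/-- `b = (η b, 0) ∈ Γ` is the `b`-axis element `b^{ι(1)}`. [cite: MochizukiEtTh2009, §1 p.12] -/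
theorem gfpOf_of_one_eq_bPowGfp : gfpOf (FreeGroup.of 1) = bPowGfp (iotaZ (Multiplicative.ofAdd 1)) := by
  apply Subtype.ext
  refine Prod.ext ?_ ?_
  · show eta (FreeGroup.of 1) = bPow (iotaZ (Multiplicative.ofAdd 1))
    rw [bPow_iotaZ_one]
  · show expA (FreeGroup.of 1) = 1
    rw [expA_apply, heisHom_of_one]
    rfl

/-- `b` lies in the decomposition group `b^Ẑ ⋊ G_{ℚ_p}` of the synthetic cusp of `curveχq′`. [cite: MochizukiEtTh2009, §1 p.13] -/
theorem inl_gfpOf_one_mem_cuspDecompχq :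
    (SemidirectProduct.inl (gfpOf (FreeGroup.of 1)) : PiTpχq p i j) ∈ cuspDecompχq p i j := by
  rw [mem_cuspDecompχq_iff, SemidirectProduct.left_inl, gfpOf_of_one_eq_bPowGfp]
  exact bPowGfp_mem_bAxisGfp _

/-- At `MuTwoSetting.modelχq′`, for an admissible `ε_Z = inclX z`: `b ∉ Π^tp_Ẍ` and `b·z⁻¹ ∉ Π^tp_Ẍ`.
[cite: MochizukiEtTh2009, Def 1.7 p.27] -/
theorem not_mem_Xddχq_and_not_mul_inv_mem {εZ : PiTpCq p i j}
    (hZ : (MuTwoSetting.modelχq' p i j hj).IsAdmissibleEpsZ εZ) {z : PiTpχq p i j}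
    (hz : (SemidirectProduct.inl z : PiTpCq p i j) = εZ) :
    (SemidirectProduct.inl (gfpOf (FreeGroup.of 1)) : PiTpχq p i j) ∉ Xddχq p i j hj ∧
      (SemidirectProduct.inl (gfpOf (FreeGroup.of 1)) : PiTpχq p i j) * z⁻¹ ∉ Xddχq p i j hj := by
  refine ⟨inl_b_not_mem_Xddχq p i j hj, fun h => ?_⟩
  have h3 := hZ.2.2
  apply h3
  change εZ * (SemidirectProduct.inl (SemidirectProduct.inl (gfpOf (FreeGroup.of 1)) : PiTpχq p i j))⁻¹ ∈
    (Xddχq p i j hj).map (SemidirectProduct.inl : PiTpχq p i j →* PiTpCq p i j)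
  rw [← hz, ← map_inv, ← map_mul, Subgroup.mem_map_iff_mem (MuTwoSetting.modelχq' p i j hj).injective_inclX]
  have : z * (SemidirectProduct.inl (gfpOf (FreeGroup.of 1)) : PiTpχq p i j)⁻¹ =
      ((SemidirectProduct.inl (gfpOf (FreeGroup.of 1)) : PiTpχq p i j) * z⁻¹)⁻¹ := by group
  rw [this]
  exact (Xddχq p i j hj).inv_mem h

/-- **`DotCCusp` is EMPTY over `MuTwoSetting.modelχq′` for every admissible `ε_Z`.** [cite: MochizukiEtTh2009, Thm 1.10 (iii) p.30] -/
theorem isEmpty_dotCCusp_modelχq' {εZ : PiTpCq p i j} (hZ : (MuTwoSetting.modelχq' p i j hj).IsAdmissibleEpsZ εZ) :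
    IsEmpty ((MuTwoSetting.modelχq' p i j hj).DotCCusp εZ) := by
  refine ⟨fun C => ?_⟩
  obtain ⟨z, hz⟩ := hZ.1
  obtain ⟨h1, h2⟩ := not_mem_Xddχq_and_not_mul_inv_mem p i j hj hZ hz
  rcases C.mem_GtpXdd_or_of_mem_decomp hZ hz (d := SemidirectProduct.inl (gfpOf (FreeGroup.of 1)))
      (inl_gfpOf_one_mem_cuspDecompχq p i j) with h | h
  · exact h1 h
  · exact h2 h

/-- **`DotCCuspTorsor` is EMPTY over `MuTwoSetting.modelχq′` for every admissible `ε_Z`.**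
[cite: MochizukiEtTh2009, Thm 1.10 (iii) p.30] -/
theorem isEmpty_dotCCuspTorsor_modelχq' {εZ : PiTpCq p i j} (hZ : (MuTwoSetting.modelχq' p i j hj).IsAdmissibleEpsZ εZ) :
    IsEmpty ((MuTwoSetting.modelχq' p i j hj).DotCCuspTorsor εZ) := by
  refine ⟨fun C => ?_⟩
  obtain ⟨z, hz⟩ := hZ.1
  obtain ⟨h1, h2⟩ := not_mem_Xddχq_and_not_mul_inv_mem p i j hj hZ hz
  rcases C.mem_GtpXdd_or_of_mem_decomp hZ hz (d := SemidirectProduct.inl (gfpOf (FreeGroup.of 1)))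
      (inl_gfpOf_one_mem_cuspDecompχq p i j) with h | h
  · exact h1 h
  · exact h2 h

/-- In particular at R244's admissible `ε_Z := a`. [cite: MochizukiEtTh2009, Def 1.7 p.27] -/
theorem isEmpty_dotCCusp_modelχq'_epsZCq : IsEmpty ((MuTwoSetting.modelχq' p i j hj).DotCCusp (epsZCq p i j)) :=
  isEmpty_dotCCusp_modelχq' p i j hj (MuTwoSetting.modelχq'_isAdmissibleEpsZ p i j hj)

include hj in
/-- **Census form at stage 2**: for every `i` and even `j`, a `MuTwoSetting` over the cusped stage-2 carrier with the guard,
a cusp and an admissible `ε_Z`, at which NO admissible `ε_Z` carries a `DotCCusp` or a `DotCCuspTorsor`.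
[cite: MochizukiEtTh2009, Thm 1.10 (iii) p.30] -/
theorem _root_.Literature.AnabelianGeometry.EtaleTheta.MuTwoSetting.exists_tate_isCusp_and_forall_isEmpty_dotCCusp :
    ∃ M : MuTwoSetting p, M.toTemperedCurve = curveχq' p i j ∧ M.toThetaSetting.IsEtThOrigin ∧ (∃ x : M.Pt, M.IsCusp x) ∧
      (∃ εZ : M.GtpC, M.IsAdmissibleEpsZ εZ) ∧
      ∀ εZ : M.GtpC, M.IsAdmissibleEpsZ εZ → IsEmpty (M.DotCCusp εZ) ∧ IsEmpty (M.DotCCuspTorsor εZ) :=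
  ⟨MuTwoSetting.modelχq' p i j hj, rfl, MuTwoSetting.modelχq'_isEtThOrigin p i j hj, ⟨(), trivial⟩,
    ⟨_, MuTwoSetting.modelχq'_isAdmissibleEpsZ p i j hj⟩,
    fun _ hZ => ⟨isEmpty_dotCCusp_modelχq' p i j hj hZ, isEmpty_dotCCuspTorsor_modelχq' p i j hj hZ⟩⟩

end Literature.AnabelianGeometry.EtaleTheta.SettingModel

end
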